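import Summits.CriticalPhenomena.PercolationContinuityZ3.Theorems.PercNearOneGluingNoHeavyLowerTailAntitheticLobeFlip
import HarnessLib

/-!
# `NoHeavyLowerTail` (stmt-CriticalPhenomena-4575) — antithetic cluster pairs: the FIRM FAMILY THEOREM (core of THEOREM D⁺)
# (prim-hp-2 gen 50, MEMO-gen50 §2 (L2⁺))

Support file (`--supports stmt-CriticalPhenomena-4575`, hull-port prover `prim-hp-2`, gen 50).  No definitions, no named facts, no sorries;
standard axioms.

Setting as in `…AntitheticLobeFlip`: a colouring `x` of `E` with red vertex cluster `J`, blue vertex cluster `U`, and pairwise disjoint closed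
sets `M i` of blue-only vertices covering `U ∖ J` (the blue lobes); `y_T = x ∆ {e ∈ E : e meets ⋃_{i∈T} M i}`.

THEOREM D⁺ (MEMO-gen50 §2): on every finite graph, for every source and every forbidden set `R`, the antithetic sum of `Δ_{F,G}` over the
FIRM slice — configurations whose core `W ∩ W'` is connected in red AND in blue inside itself — is nonnegative (vertex version); it contains
THEOREM D's slice `W ∩ W' = {s}`.  The firm slice is the disjoint union of flip families of firm nested bottoms, and THIS file proves the
family inequality:
* `Antithetic.firm_family_sum_nonneg` — if every vertex of `J` stays blue-reached when ALL lobes are flipped to red ("firm"), then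
  `0 ≤ Σ_{T ⊆ ι} Δ(y_T)`: the canonical cube of `x` (`lobecube_sum_nonneg`) controls the half `T ∋ i₀`, the canonical cube of the partner
  colouring `(y_univ)ᶜ` — red cluster `J`, blue cluster `J ∪ ⋃ M i`, same lobes — the half `T ∌ i₀`.
* `Antithetic.deltaV_compl`, `Antithetic.compl_symmDiff_left` — bookkeeping.
[cite: VandenbergHaggstromKahn2005, §1 p. 6 ("Harris' inequality")]
-/

noncomputable section

namespace Summit.CriticalPhenomena.PercolationContinuityZ3.Theorems

open Literature.Probability.Percolation
open scoped Classical symmDiff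

namespace Antithetic

section FirmFamily

variable {V : Type*} {ι : Type*} [Fintype ι]

/-- `Δ` is invariant under complementing the colouring (the two clusters swap). [folklore] -/
theorem deltaV_compl (E ω : Set (Sym2 V)) (s : V) (F G : Set V → ℝ) :
    (F (openCluster (ωᶜ ∩ E) s) - F (openCluster (ωᶜᶜ ∩ E) s)) * (G (openCluster (ωᶜ ∩ E) s) - G (openCluster (ωᶜᶜ ∩ E) s)) =
      (F (openCluster (ω ∩ E) s) - F (openCluster (ωᶜ ∩ E) s)) * (G (openCluster (ω ∩ E) s) - G (openCluster (ωᶜ ∩ E) s)) := by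
  rw [compl_compl]; ring

/-- Complement commutes with a flip: `(a ∆ b)ᶜ = aᶜ ∆ b`. [folklore] -/
theorem compl_symmDiff_left (a b : Set (Sym2 V)) : (a ∆ b)ᶜ = aᶜ ∆ b := by
  ext e
  simp only [Set.mem_compl_iff, Set.mem_symmDiff]
  tauto

/-- **FIRM FAMILY THEOREM** (MEMO-gen50 §2 (L2⁺), the analytic core of THEOREM D⁺).  Let `x` be a colouring with red cluster `J`, blue cluster `U`,
and let `M i` (`i : ι`) be pairwise disjoint closed sets of blue-only vertices covering `U ∖ J` (the blue lobes of `x`).  Suppose `x` is FIRM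
on the blue side: every vertex of `J` is still blue-reached when ALL the `M i` are flipped to red (e.g. `G[J]` is connected in blue inside `J`).
Then the WHOLE flip family has nonnegative antithetic sum: `0 ≤ Σ_{T ⊆ ι} Δ(x ∆ {e ∈ E : e meets ⋃_{i∈T} M i})` for increasing vertex
functions `F, G`.  Proof: the canonical cube of `x` gives the half `T ∋ i₀`, the canonical cube of the partner `x' = (y_univ)ᶜ` — which is a
colouring with red cluster `J`, blue cluster `J ∪ ⋃ M i` and the same lobes — gives the half `T ∌ i₀`. [this work] -/
theorem firm_family_sum_nonneg (E x : Set (Sym2 V)) (s : V) (M : ι → Set V) (i₀ : ι)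
    (hMU : ∀ i, M i ⊆ openCluster (xᶜ ∩ E) s) (hMJ : ∀ i, Disjoint (M i) (openCluster (x ∩ E) s))
    (hcl : ∀ i a b, s(a, b) ∈ E → a ∈ M i → b ∈ openCluster (xᶜ ∩ E) s → b ∉ openCluster (x ∩ E) s → b ∈ M i)
    (hcov : openCluster (xᶜ ∩ E) s \ openCluster (x ∩ E) s ⊆ ⋃ i, M i)
    (hdisj : ∀ i j, i ≠ j → Disjoint (M i) (M j))
    (hfirm : openCluster (x ∩ E) s ⊆ openCluster ((x ∆ {e | e ∈ E ∧ ∃ v ∈ e, v ∈ ⋃ i, M i})ᶜ ∩ E) s)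
    {F G : Set V → ℝ} (hF : Monotone F) (hG : Monotone G) :
    0 ≤ ∑ T : Set ι, (F (openCluster ((x ∆ {e | e ∈ E ∧ ∃ v ∈ e, v ∈ ⋃ i ∈ T, M i}) ∩ E) s) -
        F (openCluster ((x ∆ {e | e ∈ E ∧ ∃ v ∈ e, v ∈ ⋃ i ∈ T, M i})ᶜ ∩ E) s)) *
      (G (openCluster ((x ∆ {e | e ∈ E ∧ ∃ v ∈ e, v ∈ ⋃ i ∈ T, M i}) ∩ E) s) -
        G (openCluster ((x ∆ {e | e ∈ E ∧ ∃ v ∈ e, v ∈ ⋃ i ∈ T, M i})ᶜ ∩ E) s)) := by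
  -- notation
  set J := openCluster (x ∩ E) s with hJ
  set U := openCluster (xᶜ ∩ E) s with hU
  let Fl : Set V → Set (Sym2 V) := fun S => {e | e ∈ E ∧ ∃ v ∈ e, v ∈ S}
  let y : Set ι → Set (Sym2 V) := fun T => x ∆ Fl (⋃ i ∈ T, M i)
  let Δ : Set (Sym2 V) → ℝ := fun ω =>
    (F (openCluster (ω ∩ E) s) - F (openCluster (ωᶜ ∩ E) s)) * (G (openCluster (ω ∩ E) s) - G (openCluster (ωᶜ ∩ E) s))
  show 0 ≤ ∑ T : Set ι, Δ (y T)
  have hΔc : ∀ ω, Δ ωᶜ = Δ ω := fun ω => deltaV_compl E ω s F G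
  -- flip sets of disjoint closed families are disjoint; Fl is additive
  have Fl_union : ∀ S S' : Set V, Fl (S ∪ S') = Fl S ∪ Fl S' := by
    intro S S'; ext e
    simp only [Fl, Set.mem_setOf_eq, Set.mem_union]
    constructor
    · rintro ⟨hE, v, hv, hvS | hvS⟩
      · exact Or.inl ⟨hE, v, hv, hvS⟩
      · exact Or.inr ⟨hE, v, hv, hvS⟩
    · rintro (⟨hE, v, hv, hvS⟩ | ⟨hE, v, hv, hvS⟩)
      · exact ⟨hE, v, hv, Or.inl hvS⟩
      · exact ⟨hE, v, hv, Or.inr hvS⟩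
  have MT_union : ∀ T : Set ι, (⋃ i ∈ T, M i) ∪ (⋃ i ∈ Tᶜ, M i) = ⋃ i, M i := by
    intro T; ext v
    simp only [Set.mem_union, Set.mem_iUnion]
    constructor
    · rintro (⟨i, _, h⟩ | ⟨i, _, h⟩) <;> exact ⟨i, h⟩
    · rintro ⟨i, h⟩
      by_cases hi : i ∈ T
      · exact Or.inl ⟨i, hi, h⟩
      · exact Or.inr ⟨i, hi, h⟩
  have Fl_disj : ∀ T : Set ι, Disjoint (Fl (⋃ i ∈ T, M i)) (Fl (⋃ i ∈ Tᶜ, M i)) := by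
    intro T
    refine Set.disjoint_left.2 fun e he he' => ?_
    obtain ⟨hE, v, hv, hvT⟩ := he
    obtain ⟨-, w, hw, hwT⟩ := he'
    obtain ⟨i, hi, hvi⟩ := Set.mem_iUnion₂.1 hvT
    obtain ⟨j, hj, hwj⟩ := Set.mem_iUnion₂.1 hwT
    have hij : i ≠ j := fun h => hj (h ▸ hi)
    -- e = s(v,w) up to order; v ∈ M i, w ∈ M j adjacent (or v = w): closedness of M i forces w ∈ M i
    have hwU : w ∈ U := hMU j hwj
    have hwJ : w ∉ J := fun h => Set.disjoint_left.1 (hMJ j) hwj h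
    have hw_i : w ∈ M i := by
      induction e using Sym2.ind with
      | h a b =>
        rcases Sym2.mem_iff.1 hv with rfl | rfl <;> rcases Sym2.mem_iff.1 hw with rfl | rfl
        · exact hvi
        · exact hcl i _ _ hE hvi hwU hwJ
        · exact hcl i _ _ (by rw [Sym2.eq_swap]; exact hE) hvi hwU hwJ
        · exact hvi
    exact Set.disjoint_left.1 (hdisj i j hij) hw_i hwj
  -- the partner colouring x' := (y univ)ᶜ and its family
  set xall := x ∆ Fl (⋃ i, M i) with hxall
  have hy' : ∀ T : Set ι, xallᶜ ∆ Fl (⋃ i ∈ T, M i) = (y Tᶜ)ᶜ := by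
    intro T
    rw [← compl_symmDiff_left]
    congr 1
    show (x ∆ Fl (⋃ i, M i)) ∆ Fl (⋃ i ∈ T, M i) = x ∆ Fl (⋃ i ∈ Tᶜ, M i)
    rw [symmDiff_assoc]
    congr 1
    -- Fl(all) ∆ Fl(M_T) = Fl(M_{Tᶜ})
    rw [← MT_union T, Fl_union]
    have hd := Fl_disj T
    ext e
    simp only [Set.mem_symmDiff, Set.mem_union]
    constructor
    · rintro (⟨h1 | h1, h2⟩ | ⟨h1, h2⟩)
      · exact absurd h1 h2
      · exact h1
      · exact absurd (Or.inl h1) h2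
    · intro h
      exact Or.inl ⟨Or.inr h, fun h' => Set.disjoint_left.1 hd h' h⟩
  -- clusters of x'
  have hUall : openCluster (xall ∩ E) s = J ∪ ⋃ i, M i := by
    have h := lobeflip_red_eq E x s (⋃ i, M i) (Set.iUnion_subset hMU)
      (Set.disjoint_left.2 fun v hv hvJ => by
        obtain ⟨i, hvi⟩ := Set.mem_iUnion.1 hv
        exact Set.disjoint_left.1 (hMJ i) hvi hvJ)
      (fun a b hE ha hbU hbJ => by
        obtain ⟨i, hai⟩ := Set.mem_iUnion.1 ha
        exact Set.mem_iUnion.2 ⟨i, hcl i a b hE hai hbU hbJ⟩)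
    exact h
  have hJall : openCluster (xallᶜ ∩ E) s = J := by
    apply Set.Subset.antisymm
    · intro v hv
      have h := lobeflip_blue_subset E x s ∅ (⋃ i, M i) (Set.empty_subset _)
        (Set.disjoint_left.2 fun v hv hvJ => by
          obtain ⟨i, hvi⟩ := Set.mem_iUnion.1 hv
          exact Set.disjoint_left.1 (hMJ i) hvi hvJ)
        (fun a b hE ha hbU hbJ => by
          obtain ⟨i, hai⟩ := Set.mem_iUnion.1 ha
          exact Set.mem_iUnion.2 ⟨i, hcl i a b hE hai hbU hbJ⟩) hv
      have h0 : {e : Sym2 V | e ∈ E ∧ ∃ v ∈ e, v ∈ (∅ : Set V)} = ∅ := by ext e; simp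
      have hx0 : x ∆ (∅ : Set (Sym2 V)) = x := by
        rw [Set.symmDiff_def, Set.sdiff_empty, Set.empty_sdiff, Set.union_empty]
      rw [h0, hx0] at h
      -- v ∈ U and v ∉ ⋃ M i, hence v ∈ J by the cover
      by_contra hvJ
      exact h.2 (hcov ⟨h.1, hvJ⟩)
    · exact hfirm
  -- cube for x (half `T ∋ i₀`)
  let High : Set (Set ι) := {T | i₀ ∈ T}
  have hup : ∀ T T', T ∈ High → T ⊆ T' → T' ∈ High := fun T T' hT hTT' => hTT' hT
  have hsd : ∀ T, T ∈ High ↔ Tᶜ ∉ High := fun T => by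
    show i₀ ∈ T ↔ ¬ (i₀ ∈ Tᶜ)
    rw [Set.mem_compl_iff, not_not]
  have h1 := lobecube_sum_nonneg E x s M hMU hMJ hcl hcov High hup hsd hF hG
  -- cube for x' (half `T ∌ i₀`)
  have hMU' : ∀ i, M i ⊆ openCluster (xallᶜᶜ ∩ E) s := fun i => by
    rw [compl_compl, hUall]; exact Set.subset_union_of_subset_right (Set.subset_iUnion M i) J
  have hMJ' : ∀ i, Disjoint (M i) (openCluster (xallᶜ ∩ E) s) := fun i => by rw [hJall]; exact hMJ i
  have hcl' : ∀ i a b, s(a, b) ∈ E → a ∈ M i → b ∈ openCluster (xallᶜᶜ ∩ E) s → b ∉ openCluster (xallᶜ ∩ E) s → b ∈ M i := by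
    intro i a b hE ha hb hbJ
    rw [compl_compl, hUall] at hb
    rw [hJall] at hbJ
    rcases hb with hb | hb
    · exact absurd hb hbJ
    · obtain ⟨j, hbj⟩ := Set.mem_iUnion.1 hb
      exact hcl i a b hE ha (hMU j hbj) hbJ
  have hcov' : openCluster (xallᶜᶜ ∩ E) s \ openCluster (xallᶜ ∩ E) s ⊆ ⋃ i, M i := by
    rw [compl_compl, hUall, hJall]
    rintro v ⟨hv | hv, hvJ⟩
    · exact absurd hv hvJ
    · exact hv
  have h2 := lobecube_sum_nonneg E xallᶜ s M hMU' hMJ' hcl' hcov' High hup hsd hF hG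
  -- combine: termwise the two cube slots at T contribute Δ(y T) + Δ(y Tᶜ)
  have hsum : ∀ T : Set ι,
      Δ (if T ∈ High then y T else (y Tᶜ)ᶜ) + Δ (if T ∈ High then xallᶜ ∆ Fl (⋃ i ∈ T, M i) else (xallᶜ ∆ Fl (⋃ i ∈ Tᶜ, M i))ᶜ) =
        Δ (y T) + Δ (y Tᶜ) := by
    intro T
    by_cases hT : T ∈ High
    · rw [if_pos hT, if_pos hT, hy' T, hΔc]
    · rw [if_neg hT, if_neg hT, hy' Tᶜ, compl_compl, compl_compl, hΔc, add_comm]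
  have hcompl : ∑ T : Set ι, Δ (y Tᶜ) = ∑ T : Set ι, Δ (y T) :=
    Fintype.sum_equiv (Equiv.mk compl compl compl_compl compl_compl) _ _ fun T => rfl
  have htot : ∑ T : Set ι, (Δ (if T ∈ High then y T else (y Tᶜ)ᶜ) +
      Δ (if T ∈ High then xallᶜ ∆ Fl (⋃ i ∈ T, M i) else (xallᶜ ∆ Fl (⋃ i ∈ Tᶜ, M i))ᶜ)) = 2 * ∑ T : Set ι, Δ (y T) := by
    rw [Finset.sum_congr rfl fun T _ => hsum T, Finset.sum_add_distrib, hcompl]; ring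
  have hnn : 0 ≤ ∑ T : Set ι, (Δ (if T ∈ High then y T else (y Tᶜ)ᶜ) +
      Δ (if T ∈ High then xallᶜ ∆ Fl (⋃ i ∈ T, M i) else (xallᶜ ∆ Fl (⋃ i ∈ Tᶜ, M i))ᶜ)) := by
    rw [Finset.sum_add_distrib]
    refine add_nonneg ?_ ?_
    · refine h1.trans_eq (Finset.sum_congr rfl fun T _ => ?_)
      by_cases hT : T ∈ High <;> simp only [hT, if_true, if_false, Δ, y, Fl]
    · refine h2.trans_eq (Finset.sum_congr rfl fun T _ => ?_)
      by_cases hT : T ∈ High <;> simp only [hT, if_true, if_false, Δ, Fl]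
  rw [htot] at hnn
  linarith

end FirmFamily

end Antithetic

end Summit.CriticalPhenomena.PercolationContinuityZ3.Theorems
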